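import Summits.SmoothPoincare4.SmoothPoincare4.Theorems.ConvexBisectionAcyclicBisectionExistsPageTwistingTransverse
import Mathlib.Analysis.SpecialFunctions.Complex.LogDeriv
import Mathlib.Analysis.SpecialFunctions.SmoothTransition
import HarnessLib

/-!
# The fibred orientation-reversing involution of the Lefschetz base, I: the ambient map
(wave 2, node "fibred orientation-reversing involution `σ` of `Base g`" of stub
`stub_steinRealisation` = NF6 `Literature.Geometry.Symplectic.LefschetzSteinRealisation`, line
`modp-braid-orbits` r11, crux `ConvexBisection.AcyclicBisectionExists`, item
stmt-SmoothPoincare4-10508; registered sub-goal `helper_w_baseReflectionAmb`)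

WHY (W3 report §3 (b) = W7 report "ORIENTATION is real content"): `ModelsOnFibred` does not fix
the orientation character of the gluing `Ψ`, so the dual Lefschetz link of the cap comes out
uniformly signed but of EITHER sign; complex conjugation of `ℂ²` preserves the orientation and
cannot repair this.  What repairs it is an orientation-REVERSING self-diffeomorphism of the base
`Base g = {rho g ≤ 1/4} ⊂ ℂ²` (`LefschetzBaseRegular.lean`) preserving `w = y² − x^{2g+1} − 1`
(hence `rho`, every page `page g c` as a set and the binding): transporting a framed page curve
along it negates the page twisting (`…BaseReflectionTwisting.lean`).

THE MAP.  With `Φ = 1 + w = y² − x^{2g+1}`, `Re Φ ≥ 1/2` on the base (`‖w‖ ≤ 1/2`), put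
`a = arg Φ` (smooth there: the imaginary part of the principal logarithm on the slit plane),
`μ = e^{ia}`, `λ = e^{2ia/(2g+1)}` and

  `σ(x, y) = (λ x̄, μ ȳ)`.

Then `Φ(σ q) = μ² ȳ² − λ^{2g+1} x̄^{2g+1} = e^{2ia} conj(Φ q) = Φ q`, so `w ∘ σ = w`, `‖x‖` is
preserved, `rho ∘ σ = rho`, and `σ ∘ σ = id` (`λ`, `μ` are unimodular functions of `w`).  To get a
smooth map of all of `ℝ⁴` the angle is cut off: `a(w) = χ(w) · arg(1 + w)` with `χ = 1` on
`Re w ≥ -5/8` and `χ = 0` on `Re w ≤ -3/4` (§1); everything is honest on the open REGION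
`reflRegion g = {Re w > -5/8} ⊇ {‖w‖ ≤ 1/2} ⊇ {rho ≤ 1/4}`.

* §1 the smooth fibre angle `reflArg`, the unimodular factors `reflMu = μ`, `reflLam = λ`,
  `μ² = λ^{2g+1} = e^{2ia}` and the key identity `e^{2ia} · conj(1 + w) = 1 + w` on the region;
* §2 the ambient map `baseReflectionAmb g = σ` (smooth on `ℝ⁴`), `w ∘ σ = w`, `rho ∘ σ = rho`,
  `σ ∘ σ = id` on the region (`helper_w_baseReflectionAmb`), and the first-order consequences
  `dw_{σp} ∘ dσ_p = dw_p` and `⟪dσ_p V, n(σ p)⟫ = ⟪V, n(p)⟫` for the horizontal normal `n`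
  (`inner_fderiv_baseReflectionAmb_horizNormal`; `⟪·, n⟫ = Im(w̄ dΦ(·))/‖dΦ‖²`).

Sequels: `…BaseReflectionDeriv.lean` (`dσ = A + u ⊗ f`, `det dσ = -1`), `…BaseReflection.lean`
(the diffeomorphism `baseReflection g` of `Base g`), `…BaseReflectionTwisting.lean` (page twisting
is negated).  Everything is proved; no named facts, no `sorry`.  References: J. B. Etnyre,
T. Fuller, *Realizing 4-manifolds as achiral Lefschetz fibrations*, IMRN 2006, §2
[EtnyreFuller2006]; R. İ. Baykur, *Kähler decomposition of 4-manifolds*, AGT 6 (2006) ("a NALF on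
`X₋` is a PALF on `−X₋`").
-/

noncomputable section

set_option linter.dupNamespace false

open scoped Manifold ContDiff Topology ComplexConjugate
open Set Function Metric Complex
open Literature.Topology.FourManifolds Literature.Topology.FourManifolds.LefschetzBase

namespace Summit.SmoothPoincare4.SmoothPoincare4.Theorems.AcyclicBisectionExists.ModpBraidOrbits

variable {g : ℕ}

/-! ## §1 The smooth fibre angle `arg (1 + w)` and the unimodular factors `λ`, `μ` -/

/-- The cut-off `χ(u) = smoothTransition (8 Re u + 6)`: `0` for `Re u ≤ -3/4`, `1` for
`Re u ≥ -5/8` (so `χ = 1` wherever `‖u‖ ≤ 5/8`, in particular on the base `‖w‖ ≤ 1/2`). [folklore] -/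
def reflCut (u : ℂ) : ℝ := Real.smoothTransition (8 * u.re + 6)

/-- **The fibre angle** `a(u) = χ(u) · arg (1 + u)`: the argument of `Φ = 1 + w` (`Re Φ > 0` near the
base), cut off to a smooth function on all of `ℂ`. [folklore] -/
def reflArg (u : ℂ) : ℝ := reflCut u * arg (1 + u)

/-- The unimodular factor `μ(u) = exp (i a(u))` of the `y`-coordinate. [folklore] -/
def reflMu (u : ℂ) : ℂ := exp ((reflArg u : ℝ) * I)

/-- The unimodular factor `λ(u) = exp (2 i a(u) / (2g+1))` of the `x`-coordinate. [folklore] -/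
def reflLam (g : ℕ) (u : ℂ) : ℂ := exp ((2 / (2 * g + 1) * reflArg u : ℝ) * I)

/-- `χ = 1` on `Re u ≥ -5/8`. [folklore] -/
theorem reflCut_eq_one {u : ℂ} (h : -5 / 8 ≤ u.re) : reflCut u = 1 :=
  Real.smoothTransition.one_of_one_le (by linarith)

/-- `χ = 0` on `Re u ≤ -3/4`. [folklore] -/
theorem reflCut_eq_zero {u : ℂ} (h : u.re ≤ -3 / 4) : reflCut u = 0 :=
  Real.smoothTransition.zero_of_nonpos (by linarith)

/-- The cut-off is smooth. [folklore] -/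
theorem contDiff_reflCut : ContDiff ℝ ∞ reflCut :=
  Real.smoothTransition.contDiff.comp
    ((contDiff_const.mul Complex.reCLM.contDiff).add contDiff_const)

/-- On `Re u ≥ -5/8` the fibre angle is `arg (1 + u)`. [folklore] -/
theorem reflArg_eq_arg {u : ℂ} (h : -5 / 8 ≤ u.re) : reflArg u = arg (1 + u) := by
  rw [reflArg, reflCut_eq_one h, one_mul]

/-- `1 + u` lies in the slit plane when `Re u > -1`. [folklore] -/
theorem one_add_mem_slitPlane {u : ℂ} (h : -1 < u.re) : 1 + u ∈ slitPlane :=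
  mem_slitPlane_iff.2 (Or.inl (by simp; linarith))

/-- `arg (1 + u)` is real-smooth where `Re u > -1` (the imaginary part of the principal
logarithm on the slit plane). [folklore] -/
theorem contDiffAt_arg_one_add {u : ℂ} (h : -1 < u.re) :
    ContDiffAt ℝ ∞ (fun u : ℂ => arg (1 + u)) u := by
  have h1 : ContDiffAt ℝ ∞ (fun u : ℂ => log (1 + u)) u :=
    ((contDiffAt_log (one_add_mem_slitPlane h)).restrict_scalars ℝ).comp u
      (contDiff_const.add contDiff_id).contDiffAt
  have h2 : (fun u : ℂ => arg (1 + u)) = fun u => (log (1 + u)).im := by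
    funext u; rw [log_im]
  rw [h2]
  exact Complex.imCLM.contDiff.contDiffAt.comp u h1

/-- **The fibre angle is smooth on all of `ℂ`.** [folklore] -/
theorem contDiff_reflArg : ContDiff ℝ ∞ reflArg := by
  rw [contDiff_iff_contDiffAt]
  intro u
  by_cases h : -1 < u.re
  · exact contDiff_reflCut.contDiffAt.mul (contDiffAt_arg_one_add h)
  · have hev : reflArg =ᶠ[𝓝 u] fun _ => 0 := by
      have ho : IsOpen {u' : ℂ | u'.re < -3 / 4} := isOpen_lt Complex.continuous_re continuous_const
      filter_upwards [ho.mem_nhds (show u.re < -3 / 4 by linarith)] with u' hu'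
      rw [reflArg, reflCut_eq_zero (le_of_lt hu'), zero_mul]
    exact contDiffAt_const.congr_of_eventuallyEq hev

/-- `μ` is smooth. [folklore] -/
theorem contDiff_reflMu : ContDiff ℝ ∞ reflMu :=
  ((Complex.ofRealCLM.contDiff.comp contDiff_reflArg).mul contDiff_const).cexp

/-- `λ` is smooth. [folklore] -/
theorem contDiff_reflLam (g : ℕ) : ContDiff ℝ ∞ (reflLam g) :=
  ((Complex.ofRealCLM.contDiff.comp (contDiff_const.mul contDiff_reflArg)).mul contDiff_const).cexp

/-- `‖μ‖ = 1`. [folklore] -/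
@[simp] theorem norm_reflMu (u : ℂ) : ‖reflMu u‖ = 1 := norm_exp_ofReal_mul_I _

/-- `‖λ‖ = 1`. [folklore] -/
@[simp] theorem norm_reflLam (g : ℕ) (u : ℂ) : ‖reflLam g u‖ = 1 := norm_exp_ofReal_mul_I _

/-- `μ μ̄ = 1`. [folklore] -/
@[simp] theorem reflMu_mul_conj (u : ℂ) : reflMu u * conj (reflMu u) = 1 := by
  rw [mul_conj, normSq_eq_norm_sq, norm_reflMu]; simp

/-- `λ λ̄ = 1`. [folklore] -/
@[simp] theorem reflLam_mul_conj (g : ℕ) (u : ℂ) : reflLam g u * conj (reflLam g u) = 1 := by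
  rw [mul_conj, normSq_eq_norm_sq, norm_reflLam]; simp

/-- `μ² = exp (2 i a)`. [folklore] -/
theorem reflMu_sq (u : ℂ) : reflMu u ^ 2 = exp ((2 * reflArg u : ℝ) * I) := by
  rw [reflMu, sq, ← Complex.exp_add]
  congr 1; push_cast; ring

/-- `λ^{2g+1} = exp (2 i a)`. [folklore] -/
theorem reflLam_pow (g : ℕ) (u : ℂ) : reflLam g u ^ (2 * g + 1) = exp ((2 * reflArg u : ℝ) * I) := by
  rw [reflLam, ← Complex.exp_nat_mul]
  congr 1
  have h : (2 * (g : ℂ) + 1) ≠ 0 := by norm_cast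
  push_cast
  field_simp

/-- **The key identity**: on `Re u ≥ -5/8`, `exp (2 i a(u)) · conj (1 + u) = 1 + u`
(`1 + u = r e^{ia}`, `conj (1 + u) = r e^{-ia}`). [folklore] -/
theorem exp_two_reflArg_mul_conj {u : ℂ} (h : -5 / 8 ≤ u.re) :
    exp ((2 * reflArg u : ℝ) * I) * conj (1 + u) = 1 + u := by
  rw [reflArg_eq_arg h]
  set z : ℂ := 1 + u with hz
  have hpolar : (‖z‖ : ℂ) * exp ((arg z : ℝ) * I) = z := norm_mul_exp_arg_mul_I z
  have hconj : conj z = (‖z‖ : ℂ) * exp (-((arg z : ℝ) * I)) := by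
    conv_lhs => rw [← hpolar]
    rw [map_mul, Complex.conj_ofReal, ← Complex.exp_conj, map_mul, Complex.conj_ofReal, Complex.conj_I,
      mul_neg]
  rw [hconj, mul_left_comm, ← Complex.exp_add]
  conv_rhs => rw [← hpolar]
  congr 2
  push_cast; ring

/-! ## §2 The ambient map `σ(x, y) = (λ(w) x̄, μ(w) ȳ)` -/

/-- **The fibred reflection of `ℂ²`**: `σ(x, y) = (λ(w) x̄, μ(w) ȳ)` with `w = y² − x^{2g+1} − 1`,
`μ = e^{i arg(1+w)}`, `λ = e^{2 i arg(1+w)/(2g+1)}` (near the base; cut off to a smooth map of all of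
`ℝ⁴`).  It preserves `w` and `rho`, is an involution, and reverses the orientation. [folklore] -/
def baseReflectionAmb (g : ℕ) (p : EuclideanSpace ℝ (Fin 4)) : EuclideanSpace ℝ (Fin 4) :=
  mk (reflLam g (w g p) * conj (cx p)) (reflMu (w g p) * conj (cy p))

/-- `x`-coordinate of `σ p`. [folklore] -/
@[simp] theorem cx_baseReflectionAmb (p : EuclideanSpace ℝ (Fin 4)) :
    cx (baseReflectionAmb g p) = reflLam g (w g p) * conj (cx p) := cx_mk _ _

/-- `y`-coordinate of `σ p`. [folklore] -/
@[simp] theorem cy_baseReflectionAmb (p : EuclideanSpace ℝ (Fin 4)) :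
    cy (baseReflectionAmb g p) = reflMu (w g p) * conj (cy p) := cy_mk _ _

/-- `‖x (σ p)‖ = ‖x p‖`. [folklore] -/
@[simp] theorem norm_cx_baseReflectionAmb (p : EuclideanSpace ℝ (Fin 4)) :
    ‖cx (baseReflectionAmb g p)‖ = ‖cx p‖ := by
  rw [cx_baseReflectionAmb, norm_mul, norm_reflLam, one_mul, Complex.norm_conj]

/-- `‖y (σ p)‖ = ‖y p‖`. [folklore] -/
@[simp] theorem norm_cy_baseReflectionAmb (p : EuclideanSpace ℝ (Fin 4)) :
    ‖cy (baseReflectionAmb g p)‖ = ‖cy p‖ := by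
  rw [cy_baseReflectionAmb, norm_mul, norm_reflMu, one_mul, Complex.norm_conj]

/-- `w (σ p) + 1 = exp (2 i a) · conj (w p + 1)` everywhere. [folklore] -/
theorem w_baseReflectionAmb_add_one (p : EuclideanSpace ℝ (Fin 4)) :
    w g (baseReflectionAmb g p) + 1 = exp ((2 * reflArg (w g p) : ℝ) * I) * conj (w g p + 1) := by
  have hw : ∀ q : EuclideanSpace ℝ (Fin 4), w g q + 1 = cy q ^ 2 - cx q ^ (2 * g + 1) := fun q => by
    simp only [w, Phi]; ring
  rw [hw, hw, cx_baseReflectionAmb, cy_baseReflectionAmb, mul_pow, mul_pow, reflMu_sq, reflLam_pow,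
    map_sub, map_pow, map_pow]
  ring

/-- **The region where `σ` is honest**: `Re w > -5/8` (an open neighbourhood of the base, on which
the cut-off is `1`). [folklore] -/
def reflRegion (g : ℕ) : Set (EuclideanSpace ℝ (Fin 4)) := {p | -5 / 8 < (w g p).re}

/-- The region is open. [folklore] -/
theorem isOpen_reflRegion (g : ℕ) : IsOpen (reflRegion g) :=
  isOpen_lt continuous_const (Complex.continuous_re.comp (contDiff_w g).continuous)

/-- Points with `‖w‖ ≤ 1/2` (e.g. the base `rho ≤ 1/4`) lie in the region. [folklore] -/
theorem mem_reflRegion_of_norm_w_le {p : EuclideanSpace ℝ (Fin 4)} (h : ‖w g p‖ ≤ 1 / 2) :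
    p ∈ reflRegion g := by
  have := (abs_re_le_norm (w g p)).trans h
  show -5 / 8 < (w g p).re
  have := neg_abs_le (w g p).re
  linarith

/-- Points of `{rho ≤ 1/4}` lie in the region. [folklore] -/
theorem mem_reflRegion_of_rho_le {p : EuclideanSpace ℝ (Fin 4)} (h : rho g p ≤ 1 / 4) :
    p ∈ reflRegion g := by
  refine mem_reflRegion_of_norm_w_le ?_
  have := (bounds_of_rho_le g h).2
  nlinarith [norm_nonneg (w g p)]

/-- **`σ` preserves `w`** on the region. [folklore] -/
theorem w_baseReflectionAmb {p : EuclideanSpace ℝ (Fin 4)} (hp : p ∈ reflRegion g) :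
    w g (baseReflectionAmb g p) = w g p := by
  have h := w_baseReflectionAmb_add_one (g := g) p
  rw [add_comm (w g p) 1, exp_two_reflArg_mul_conj (le_of_lt hp)] at h
  linear_combination h

/-- **`σ` preserves `rho`** on the region. [folklore] -/
theorem rho_baseReflectionAmb {p : EuclideanSpace ℝ (Fin 4)} (hp : p ∈ reflRegion g) :
    rho g (baseReflectionAmb g p) = rho g p := by
  rw [rho, rho, w_baseReflectionAmb hp, norm_cx_baseReflectionAmb]

/-- `σ` maps the region to itself. [folklore] -/
theorem baseReflectionAmb_mem_reflRegion {p : EuclideanSpace ℝ (Fin 4)} (hp : p ∈ reflRegion g) :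
    baseReflectionAmb g p ∈ reflRegion g := by
  show -5 / 8 < (w g (baseReflectionAmb g p)).re
  rw [w_baseReflectionAmb hp]; exact hp

/-- **`σ` is an involution** on the region. [folklore] -/
theorem baseReflectionAmb_baseReflectionAmb {p : EuclideanSpace ℝ (Fin 4)} (hp : p ∈ reflRegion g) :
    baseReflectionAmb g (baseReflectionAmb g p) = p := by
  refine ext_cx_cy ?_ ?_
  · rw [cx_baseReflectionAmb, cx_baseReflectionAmb, w_baseReflectionAmb hp, map_mul, Complex.conj_conj,
      ← mul_assoc, reflLam_mul_conj, one_mul]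
  · rw [cy_baseReflectionAmb, cy_baseReflectionAmb, w_baseReflectionAmb hp, map_mul, Complex.conj_conj,
      ← mul_assoc, reflMu_mul_conj, one_mul]

/-- `p ↦ conj (x p)` is smooth. [folklore] -/
theorem contDiff_conj_cx : ContDiff ℝ ∞ fun p : EuclideanSpace ℝ (Fin 4) => conj (cx p) :=
  Complex.conjCLE.contDiff.comp contDiff_cx

/-- `p ↦ conj (y p)` is smooth. [folklore] -/
theorem contDiff_conj_cy : ContDiff ℝ ∞ fun p : EuclideanSpace ℝ (Fin 4) => conj (cy p) :=
  Complex.conjCLE.contDiff.comp contDiff_cy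

/-- **`σ` is smooth on all of `ℝ⁴`.** [folklore] -/
theorem contDiff_baseReflectionAmb (g : ℕ) : ContDiff ℝ ∞ (baseReflectionAmb g) :=
  contDiff_mk₂.comp
    ((((contDiff_reflLam g).comp (contDiff_w g)).mul contDiff_conj_cx).prodMk
      ((contDiff_reflMu.comp (contDiff_w g)).mul contDiff_conj_cy))

/-- **`dσ` preserves `dw`**: `dw_{σ p}(dσ_p V) = dw_p(V)` on the region (differentiate
`w ∘ σ = w`). [folklore] -/
theorem fderiv_w_fderiv_baseReflectionAmb {p : EuclideanSpace ℝ (Fin 4)} (hp : p ∈ reflRegion g)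
    (V : EuclideanSpace ℝ (Fin 4)) :
    fderiv ℝ (w g) (baseReflectionAmb g p) (fderiv ℝ (baseReflectionAmb g) p V) = fderiv ℝ (w g) p V := by
  have hw : ∀ q, HasFDerivAt (w g) (fderiv ℝ (w g) q) q := fun q =>
    ((contDiff_w g).differentiable (by simp) q).hasFDerivAt
  have hσ : HasFDerivAt (baseReflectionAmb g) (fderiv ℝ (baseReflectionAmb g) p) p :=
    ((contDiff_baseReflectionAmb g).differentiable (by simp) p).hasFDerivAt
  have hcomp := (hw (baseReflectionAmb g p)).comp p hσ
  have hev : w g =ᶠ[𝓝 p] (w g ∘ baseReflectionAmb g) := by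
    filter_upwards [(isOpen_reflRegion g).mem_nhds hp] with q hq
    exact (w_baseReflectionAmb hq).symm
  have h := (hcomp.congr_of_eventuallyEq hev).unique (hw p)
  exact congrArg (fun L : EuclideanSpace ℝ (Fin 4) →L[ℝ] ℂ => L V) h

/-- `dΦ = (a, b)` at `σ p`: `‖a(σ p)‖ = ‖a(p)‖`. [folklore] -/
theorem norm_dPhiX_baseReflectionAmb (p : EuclideanSpace ℝ (Fin 4)) :
    ‖dPhiX g (baseReflectionAmb g p)‖ = ‖dPhiX g p‖ := by
  simp [dPhiX, norm_pow]

/-- `dΦ = (a, b)` at `σ p`: `‖b(σ p)‖ = ‖b(p)‖`. [folklore] -/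
theorem norm_dPhiY_baseReflectionAmb (p : EuclideanSpace ℝ (Fin 4)) :
    ‖dPhiY (baseReflectionAmb g p)‖ = ‖dPhiY p‖ := by
  simp [dPhiY]

/-- **`dσ` preserves the pairing with the horizontal normal**: `⟪dσ_p V, n(σ p)⟫ = ⟪V, n(p)⟫` on the
region (`⟪·, n⟫ = Im (w̄ dΦ(·)) / ‖dΦ‖²`, and `dσ` preserves `w`, `dw` and `‖dΦ‖`). [folklore] -/
theorem inner_fderiv_baseReflectionAmb_horizNormal {p : EuclideanSpace ℝ (Fin 4)} (hp : p ∈ reflRegion g)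
    (V : EuclideanSpace ℝ (Fin 4)) :
    inner ℝ (fderiv ℝ (baseReflectionAmb g) p V) (horizNormal g (baseReflectionAmb g p)) =
      inner ℝ V (horizNormal g p) := by
  rw [inner_horizNormal, inner_horizNormal, ← fderiv_w_apply, ← fderiv_w_apply,
    fderiv_w_fderiv_baseReflectionAmb hp, w_baseReflectionAmb hp, norm_dPhiX_baseReflectionAmb,
    norm_dPhiY_baseReflectionAmb]

/-- **Sub-goal `helper_w_baseReflectionAmb`** (NF6, node "fibred orientation-reversing involution
of the base", lead c5 wave 2): on the region `Re w > -5/8` (which contains `{rho ≤ 1/4} ⊇ Base g`)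
the ambient fibred reflection `σ(x, y) = (λ(w) x̄, μ(w) ȳ)` preserves `w = y² − x^{2g+1} − 1` and
`rho`, and is an involution. [folklore] -/
theorem helper_w_baseReflectionAmb : ∀ (g : ℕ) (p : EuclideanSpace ℝ (Fin 4)),
    -5 / 8 < (Literature.Topology.FourManifolds.LefschetzBase.w g p).re →
    Literature.Topology.FourManifolds.LefschetzBase.w g
        (Summit.SmoothPoincare4.SmoothPoincare4.Theorems.AcyclicBisectionExists.ModpBraidOrbits.baseReflectionAmb g p) =
      Literature.Topology.FourManifolds.LefschetzBase.w g p ∧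
    Literature.Topology.FourManifolds.LefschetzBase.rho g
        (Summit.SmoothPoincare4.SmoothPoincare4.Theorems.AcyclicBisectionExists.ModpBraidOrbits.baseReflectionAmb g p) =
      Literature.Topology.FourManifolds.LefschetzBase.rho g p ∧
    Summit.SmoothPoincare4.SmoothPoincare4.Theorems.AcyclicBisectionExists.ModpBraidOrbits.baseReflectionAmb g
        (Summit.SmoothPoincare4.SmoothPoincare4.Theorems.AcyclicBisectionExists.ModpBraidOrbits.baseReflectionAmb g p) = p :=
  fun _ _ hp => ⟨w_baseReflectionAmb hp, rho_baseReflectionAmb hp, baseReflectionAmb_baseReflectionAmb hp⟩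

end Summit.SmoothPoincare4.SmoothPoincare4.Theorems.AcyclicBisectionExists.ModpBraidOrbits

end
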